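import Summits.ResolutionOfSingularities.ResolutionOfSingularities.Theorems.EquisingularLiftEquisingularLiftNatSectionsLiftPrincipal
import Literature.AlgebraicGeometry.Modules.AffineVectorBundleSections
import Literature.AlgebraicGeometry.Modules.VectorBundleFiniteLocallyFree
import Literature.AlgebraicGeometry.Morphisms.FormalFunctionsCechProofs
import Mathlib.RingTheory.Flat.TorsionFree
import HarnessLib

/-!
# [OURS · L1 W4.5(b) · LINE (T-j)-PROOF support (G2)] Sections of a VECTOR BUNDLE on a flat `A`-scheme have no torsion by
# regular elements of `A` (`smul_eq_zero_iff_of_flat_vectorBundle`)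

Cell res-hironaka, LADDER-RESOLUTION rung L, slot W4.5(b), crux chain w45b: EL♮(3) = stmt-ResolutionOfSingularities-20148,
residue (T-j) = F-102 `Literature.AlgebraicGeometry.Resolution.GenusZeroOverCompleteDVR` (LINE (T-j)-PROOF, res-L1-w45b-lead-2 g3,
skeleton `L/res-L1-w45b-lead-2/F102Skeleton.lean`; this is the `htf` hypothesis of BRICK E `F102.exists_unitSection_eq_of_ker_le_span`
(`…NatSectionsLiftPrincipal`, p574087) in brick B4's use). By-signature request «036 → lemma (G2)» of res-L1-w45b-lead-2 (STATUS
2026-08-27T21:46:48Z); seat res-D-pv-036 g11 (on-call supplier, res-L1-w45b-plan-1 DESK WORD (α) 21:44:08Z). `--supports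
stmt-ResolutionOfSingularities-20148 --as helper`. NOT a statement of any manuscript; OURS; AI-written, weaker than expert review.
Definition-free; standard axioms.

THEOREM (`smul_eq_zero_iff_of_flat_vectorBundle`). `f : X → Spec A` FLAT, `F` a vector bundle on `X` (`Motives.IsVectorBundle`), `ϖ ∈ A`
regular, `V ⊆ X` any open, `m ∈ Γ(V, F)` (the tree's `MSections f F V` with its `A`-module structure through `A → Γ(X, V)`): `ϖ • m = 0 ⇒ m = 0`.

PROOF. On an AFFINE `W`: `Γ(F, W)` is finite projective over `Γ(X, W)` (tree `Modules/AffineVectorBundleSections`,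
`finite_projective_sections_of_isFiniteLocallyFree`, with `IsVectorBundle.isFiniteLocallyFree`), hence flat; `Γ(X, W)` is flat over `A`
(`Flat f`, tree `Morphisms/FormalFunctionsCechProofs` `Sections.flat`); so `Γ(F, W)` is a flat `A`-module (`Module.Flat.trans`) and a
regular `ϖ` is `Γ(F, W)`-regular (Mathlib `Module.Flat.isSMulRegular_of_isRegular`). Any open `V`: the affine opens below `V` cover it and
restriction is `A`-linear, so `m` dies on each of them, hence `m = 0` by locality (tree `MSections.eq_of_res_eq`). (The tree's
`Modules/FlatSectionsRegular` is the case `F = 𝒪_X`; `Modules/LocallyFreeSectionsTorsionFree` the integer-multiple case.)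
[cite: StacksProject, Tag 00HI] [cite: GortzWedhorn2020, Cor. 7.42] [folklore]
-/

noncomputable section

open CategoryTheory AlgebraicGeometry TopologicalSpace Opposite
open Literature.AlgebraicGeometry.Morphisms Literature.AlgebraicGeometry.Modules Literature.AlgebraicGeometry

set_option linter.dupNamespace false

namespace Summit.ResolutionOfSingularities.ResolutionOfSingularities.Cruxes.EquisingularLiftNat.F102

universe u

variable {A : Type u} [CommRing A] {X : Scheme.{u}} (f : X ⟶ Spec (.of A))

/-- **Affine case**: on an affine open `W` of a flat `A`-scheme, sections of a vector bundle have no torsion by regular elements of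
`A` (`Γ(F, W)` finite projective over the flat `A`-algebra `Γ(X, W)`, hence `A`-flat). [cite: StacksProject, Tag 00HI] [folklore] -/
theorem smul_eq_zero_of_flat_vectorBundle_of_isAffineOpen [Flat f] (F : X.Modules) (hF : Motives.IsVectorBundle F) (ϖ : A)
    (hϖ : IsRegular ϖ) {W : X.Opens} (hW : IsAffineOpen W) (m : MSections f F W) (hm : ϖ • m = 0) : m = 0 := by
  -- `Γ(F, W)` is projective over `Γ(X, W) = Sections f W`
  have hproj : Module.Projective (Sections f W) (MSections f F W) :=
    (finite_projective_sections_of_isFiniteLocallyFree hF.isFiniteLocallyFree hW).2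
  haveI : Module.Flat (Sections f W) (MSections f F W) := Module.Flat.of_projective
  -- `Γ(X, W)` is flat over `A`
  haveI : Module.Flat A (Sections f W) := Sections.flat f hW
  haveI : Module.Flat A (MSections f F W) := Module.Flat.trans A (Sections f W) (MSections f F W)
  have hreg : IsSMulRegular (MSections f F W) ϖ := Module.Flat.isSMulRegular_of_isRegular hϖ
  have h1 : ϖ • m = ϖ • (0 : MSections f F W) := by rw [hm, smul_zero]
  exact hreg h1

/-- **(G2) Sections of a vector bundle on a flat `A`-scheme have no torsion by regular elements of `A`** — any open `V`: `ϖ • m = 0 ⇒ m = 0`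
for `m ∈ Γ(V, F)`, `F` a vector bundle on `X`, `f : X → Spec A` flat, `ϖ ∈ A` regular (affine case + locality on the affine opens below `V`).
This is the `htf` hypothesis of BRICK E `exists_unitSection_eq_of_ker_le_span`. [cite: StacksProject, Tag 00HI] [cite: GortzWedhorn2020, Cor. 7.42]
[folklore] -/
theorem smul_eq_zero_iff_of_flat_vectorBundle [Flat f] (F : X.Modules) (hF : Motives.IsVectorBundle F) (ϖ : A) (hϖ : IsRegular ϖ)
    (V : X.Opens) (m : MSections f F V) : ϖ • m = 0 → m = 0 := by
  intro hm
  -- the affine opens below `V` cover `V`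
  let J := {W : X.affineOpens // (W : X.Opens) ≤ V}
  have hcov : V ≤ ⨆ j : J, ((j.1 : X.affineOpens) : X.Opens) := by
    intro x hx
    obtain ⟨_, ⟨W, hW, rfl⟩, hxW, hWV⟩ := X.isBasis_affineOpens.exists_subset_of_mem_open hx V.2
    exact Opens.mem_iSup.mpr ⟨⟨⟨W, hW⟩, hWV⟩, hxW⟩
  refine MSections.eq_of_res_eq f F (fun j : J => ((j.1 : X.affineOpens) : X.Opens)) (fun j => j.2) hcov fun j => ?_
  rw [map_zero]
  refine smul_eq_zero_of_flat_vectorBundle_of_isAffineOpen f F hF ϖ hϖ j.1.2 _ ?_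
  rw [← map_smul, hm, map_zero]

end Summit.ResolutionOfSingularities.ResolutionOfSingularities.Cruxes.EquisingularLiftNat.F102

end
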